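import Mathlib
import Summits.NavierStokesRegularity.NavierStokesRegularity.Theorems.EulerZoomLiouvillePowerGaugeEulerLiouvilleSelfSimilarSourceExclusion
import Summits.NavierStokesRegularity.NavierStokesRegularity.Theorems.EulerZoomLiouvillePowerGaugeEulerLiouvilleSelfSimilarAlphaLimit
import HarnessLib

/-!
# Rung C1 of the crux `EulerZoomLiouville.PowerGaugeEulerLiouville`: VORTICITY VANISHES NEAR EVERY ADAPTED SOURCE
# of the self-similar Lagrangian flow (in the window, every hyperbolic source is one)
# (route №10, item stmt-NavierStokesRegularity-19832; `--supports`)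

Helper file (theorems only). Seat ns-typeII-p3 (cell ns-regularity-ideate §B, D-0081).  Sequel to
`…SelfSimilarSourceExclusion` (Cauchy formula + exclusion along a backward orbit); KEEP-1 of the crux idea
«hyperbolic-stagnation exclusion» (evidence #41 on the item), completed:

* `adaptedSq_flow_neg_lt` — **an adapted source ball is backward invariant**: if `W(y*) = 0` and on the `G`-ball
  `{⟪G(z−y*), z−y*⟫ < r²}` the field `W = γy + V` is `G`-repelling, `⟪G DW(z)h, h⟫ ≥ μ⟪Gh, h⟫` (`μ > 0`), then every
  backward trajectory starting in the ball stays in it (first-exit argument: `ρ(t) = ⟪G(Φ_{−t}y − y*), ·⟫` is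
  non-increasing while inside);
* `curl_eq_zero_on_adaptedSourceBall` — **THE LOCAL THEOREM**: if moreover `⟪G DW(z)h, h⟫ ≤ Λ'⟪Gh, h⟫` on the ball
  with `Λ' < 1 + γ`, then `curl V ≡ 0` on the ball.  At a HYPERBOLIC SOURCE `y*` in the window `γ < ½` such
  `G, μ, Λ', r` always exist (`max Re λ(DW(y*)) < tr DW = 3γ < 1+γ`; Lyapunov's adapted inner product; continuity of
  `DV`), so: **the vorticity of an in-window classical self-similar profile vanishes identically near every
  hyperbolic source of its similarity flow** — no outgoing / stretching / analyticity hypothesis (compare CIV 2026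
  Thm 3.8 / Prop 3.9: vanishing to infinite order AT a node under the symmetric outgoing condition).

WHAT THIS IS NOT: not NS, not E, not rung C1 — a local exclusion for CLASSICAL profiles; the existence of the
adapted `G` at a hyperbolic source (linear algebra) and the global measure step (KEEP-2) are not in this file.
[folklore; cf. ConstantinIgnatovaVicol2026Putative §3.5 Thm 3.8, Prop 3.9]
-/

noncomputable section

-- flat `Theorems/<Route><Decl>…` files of one crux share the namespace of the crux (tree convention)
set_option linter.dupNamespace false

open MeasureTheory Set Filter Topology Metric Function InnerProductSpace
open scoped RealInnerProductSpace NNReal ContDiff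

namespace Summit.NavierStokesRegularity.NavierStokesRegularity.Theorems.PowerGaugeEulerLiouville.Kelvin

open Literature.Analysis Literature.Analysis.FluidPDE

variable {γ : ℝ} {V : EuclideanSpace ℝ (Fin 3) → EuclideanSpace ℝ (Fin 3)} {P : EuclideanSpace ℝ (Fin 3) → ℝ}

/-! ### The repelling inequality from the linearisation on a convex adapted ball -/

/-- On a `G`-ball around a zero `y*` of `W = γy + V` on which `⟪G DW(z)h, h⟫ ≥ μ⟪Gh, h⟫`, the field is
`G`-repelling: `⟪G W(z), z − y*⟫ ≥ μ ⟪G(z − y*), z − y*⟫` (integrate `θ ↦ ⟪G W(y* + θ(z−y*)), z − y*⟫`). [folklore] -/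
theorem adapted_inner_transport_ge (hV : ContDiff ℝ ∞ V)
    {ystar : EuclideanSpace ℝ (Fin 3)} (hstar : selfSimilarTransport γ 0 V ystar = 0)
    {G : EuclideanSpace ℝ (Fin 3) →L[ℝ] EuclideanSpace ℝ (Fin 3)}
    (hGnn : ∀ h : EuclideanSpace ℝ (Fin 3), 0 ≤ ⟪G h, h⟫) {μ r : ℝ}
    (hrep : ∀ z : EuclideanSpace ℝ (Fin 3), ⟪G (z - ystar), z - ystar⟫ < r ^ 2 →
      ∀ h : EuclideanSpace ℝ (Fin 3), μ * ⟪G h, h⟫ ≤ ⟪G (γ • h + fderiv ℝ V z h), h⟫)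
    {z : EuclideanSpace ℝ (Fin 3)} (hz : ⟪G (z - ystar), z - ystar⟫ < r ^ 2) :
    μ * ⟪G (z - ystar), z - ystar⟫ ≤ ⟪G (selfSimilarTransport γ 0 V z), z - ystar⟫ := by
  set h : EuclideanSpace ℝ (Fin 3) := z - ystar with hh
  have hVd : Differentiable ℝ V := hV.differentiable (by simp)
  -- `φ(θ) = ⟪G W(y* + θ h), h⟫`, `φ(0) = 0`, `φ(1) = ⟪G W(z), h⟫`, `φ' ≥ μ ⟪G h, h⟫`
  set φ : ℝ → ℝ := fun θ => ⟪G (selfSimilarTransport γ 0 V (ystar + θ • h)), h⟫ with hφ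
  have hline : ∀ θ : ℝ, HasDerivAt (fun θ : ℝ => ystar + θ • h) h θ := by
    intro θ
    simpa using ((hasDerivAt_id θ).smul_const h).const_add ystar
  have hWd : ∀ θ : ℝ, HasDerivAt (fun θ : ℝ => selfSimilarTransport γ 0 V (ystar + θ • h))
      (γ • h + fderiv ℝ V (ystar + θ • h) h) θ := by
    intro θ
    have h1 := (hasFDerivAt_selfSimilarTransport (γ := γ) (c := 0) hVd (ystar + θ • h)).comp_hasDerivAt θ
      (hline θ)
    refine h1.congr_deriv ?_
    simp only [_root_.add_apply, _root_.smul_apply, ContinuousLinearMap.id_apply]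
  have hφd : ∀ θ : ℝ, HasDerivAt φ ⟪G (γ • h + fderiv ℝ V (ystar + θ • h) h), h⟫ θ := by
    intro θ
    have h1 : HasDerivAt (fun θ : ℝ => G (selfSimilarTransport γ 0 V (ystar + θ • h)))
        (G (γ • h + fderiv ℝ V (ystar + θ • h) h)) θ := G.hasFDerivAt.comp_hasDerivAt θ (hWd θ)
    have h2 := h1.inner ℝ (hasDerivAt_const θ h)
    exact h2.congr_deriv (by rw [inner_zero_right, zero_add])
  -- points of the segment lie in the ball
  have hseg : ∀ θ ∈ Icc (0 : ℝ) 1, ⟪G (ystar + θ • h - ystar), ystar + θ • h - ystar⟫ < r ^ 2 := by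
    intro θ hθ
    rw [add_sub_cancel_left, map_smul, real_inner_smul_left, real_inner_smul_right]
    have hθ2 : θ * θ ≤ 1 := by nlinarith [hθ.1, hθ.2]
    have hGh := hGnn h
    calc θ * (θ * ⟪G h, h⟫) = θ * θ * ⟪G h, h⟫ := by ring
      _ ≤ 1 * ⟪G h, h⟫ := mul_le_mul_of_nonneg_right hθ2 hGh
      _ = ⟪G (z - ystar), z - ystar⟫ := by rw [one_mul, hh]
      _ < r ^ 2 := hz
  have hφ' : ∀ θ ∈ interior (Icc (0 : ℝ) 1), μ * ⟪G h, h⟫ ≤ deriv φ θ := by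
    intro θ hθ
    rw [interior_Icc] at hθ
    rw [(hφd θ).deriv]
    exact hrep _ (hseg θ (Ioo_subset_Icc_self hθ)) h
  have hφc : ContinuousOn φ (Icc 0 1) := fun θ _ => (hφd θ).continuousAt.continuousWithinAt
  have hmv := (convex_Icc (0 : ℝ) 1).mul_sub_le_image_sub_of_le_deriv hφc
    (fun θ _ => (hφd θ).differentiableAt.differentiableWithinAt) hφ' 0 (left_mem_Icc.2 zero_le_one) 1
    (right_mem_Icc.2 zero_le_one) zero_le_one
  have hφ0 : φ 0 = 0 := by
    show ⟪G (selfSimilarTransport γ 0 V (ystar + (0 : ℝ) • h)), h⟫ = 0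
    rw [zero_smul, add_zero, hstar, map_zero, inner_zero_left]
  have hφ1 : φ 1 = ⟪G (selfSimilarTransport γ 0 V z), z - ystar⟫ := by
    show ⟪G (selfSimilarTransport γ 0 V (ystar + (1 : ℝ) • h)), h⟫ = _
    rw [one_smul, hh, add_sub_cancel]
  rw [hφ0, hφ1, sub_zero, sub_zero, mul_one] at hmv
  exact hmv

/-! ### Backward invariance of an adapted source ball -/

/-- **An adapted source ball is backward invariant.** Under the repelling hypothesis on the `G`-ball (`G` symmetric,
`⟪Gh,h⟫ ≥ 0`, `μ ≥ 0`), for `y` in the ball and all `t ≥ 0`: `⟪G(Φ_{−t}y − y*), Φ_{−t}y − y*⟫ ≤ ⟪G(y − y*), y − y*⟫`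
(in particular the backward orbit stays in the ball). [folklore] -/
theorem adaptedSq_flow_neg_le (hV : ContDiff ℝ ∞ V) {K : ℝ} (hK : ∀ y, ‖fderiv ℝ V y‖ ≤ K)
    {ystar : EuclideanSpace ℝ (Fin 3)} (hstar : selfSimilarTransport γ 0 V ystar = 0)
    {G : EuclideanSpace ℝ (Fin 3) →L[ℝ] EuclideanSpace ℝ (Fin 3)}
    (hGsym : ∀ u v : EuclideanSpace ℝ (Fin 3), ⟪G u, v⟫ = ⟪u, G v⟫)
    (hGnn : ∀ h : EuclideanSpace ℝ (Fin 3), 0 ≤ ⟪G h, h⟫) {μ r : ℝ} (hμ : 0 ≤ μ)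
    (hrep : ∀ z : EuclideanSpace ℝ (Fin 3), ⟪G (z - ystar), z - ystar⟫ < r ^ 2 →
      ∀ h : EuclideanSpace ℝ (Fin 3), μ * ⟪G h, h⟫ ≤ ⟪G (γ • h + fderiv ℝ V z h), h⟫)
    {y : EuclideanSpace ℝ (Fin 3)} (hy : ⟪G (y - ystar), y - ystar⟫ < r ^ 2) {t : ℝ} (ht : 0 ≤ t) :
    ⟪G (ODE.evolutionMap (fun _ : ℝ => selfSimilarTransport γ 0 V) 0 (-t) y - ystar),
        ODE.evolutionMap (fun _ : ℝ => selfSimilarTransport γ 0 V) 0 (-t) y - ystar⟫ ≤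
      ⟪G (y - ystar), y - ystar⟫ := by
  -- `ρ(t) = ⟪G(Y t − y*), Y t − y*⟫`, `Y t = Φ_{−t} y`, `ρ' = −2⟪G W(Y t), Y t − y*⟫`
  set Y : ℝ → EuclideanSpace ℝ (Fin 3) := fun t =>
    ODE.evolutionMap (fun _ : ℝ => selfSimilarTransport γ 0 V) 0 (-t) y with hYdef
  set ρ : ℝ → ℝ := fun t => ⟪G (Y t - ystar), Y t - ystar⟫ with hρ
  have hY : ∀ t, HasDerivAt (fun t => Y t - ystar) ((-1 : ℝ) • selfSimilarTransport γ 0 V (Y t)) t :=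
    fun t => (hasDerivAt_flow_neg (γ := γ) hV hK y t).sub_const ystar
  have hρ' : ∀ t, HasDerivAt ρ (2 * ⟪G ((-1 : ℝ) • selfSimilarTransport γ 0 V (Y t)), Y t - ystar⟫) t :=
    fun t => hasDerivAt_adapted_sq hGsym (hY t)
  have hρc : Continuous ρ := continuous_iff_continuousAt.2 fun t => (hρ' t).continuousAt
  have hρ0 : ρ 0 = ⟪G (y - ystar), y - ystar⟫ := by
    simp only [hρ, hYdef, neg_zero, ODE.evolutionMap_self]
  -- the derivative is `≤ 0` while inside the ball
  have hder_nonpos : ∀ t, ρ t < r ^ 2 →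
      2 * ⟪G ((-1 : ℝ) • selfSimilarTransport γ 0 V (Y t)), Y t - ystar⟫ ≤ 0 := by
    intro t hin
    have h1 := adapted_inner_transport_ge (γ := γ) hV hstar hGnn hrep hin
    have h2 : 0 ≤ μ * ⟪G (Y t - ystar), Y t - ystar⟫ := mul_nonneg hμ (hGnn _)
    rw [map_smul, real_inner_smul_left]
    linarith
  -- first-exit argument
  by_contra hcon
  push Not at hcon
  have hρ0r : ρ 0 < r ^ 2 := by rw [hρ0]; exact hy
  have hcon' : ρ 0 < ρ t := by rw [hρ0]; exact hcon
  set ε : ℝ := min ((ρ t - ρ 0) / 2) ((r ^ 2 - ρ 0) / 2) with hε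
  have hε0 : 0 < ε := lt_min (by linarith) (by linarith)
  have hε1 : ε ≤ (ρ t - ρ 0) / 2 := min_le_left _ _
  have hε2 : ε ≤ (r ^ 2 - ρ 0) / 2 := min_le_right _ _
  set T : Set ℝ := {τ | τ ∈ Icc 0 t ∧ ρ 0 + ε ≤ ρ τ} with hT
  have hTc : IsClosed T := by
    have : T = Icc 0 t ∩ {τ | ρ 0 + ε ≤ ρ τ} := by ext τ; simp [hT]
    rw [this]
    exact isClosed_Icc.inter (isClosed_le continuous_const hρc)
  have htT : t ∈ T := ⟨⟨ht, le_rfl⟩, by linarith⟩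
  have hTne : T.Nonempty := ⟨t, htT⟩
  have hTbdd : BddBelow T := ⟨0, fun τ hτ => hτ.1.1⟩
  have ht₁T : sInf T ∈ T := hTc.csInf_mem hTne hTbdd
  set t₁ := sInf T with ht₁
  have ht₁0 : 0 < t₁ := by
    rcases eq_or_lt_of_le ht₁T.1.1 with h0 | h0
    · exfalso
      have := ht₁T.2
      rw [← h0] at this
      linarith
    · exact h0
  -- on `[0, t₁)`: `ρ < ρ 0 + ε < r²`
  have hbelow : ∀ τ ∈ Ico 0 t₁, ρ τ < ρ 0 + ε := by
    intro τ hτ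
    by_contra hge
    push Not at hge
    have hτT : τ ∈ T := ⟨⟨hτ.1, (le_of_lt hτ.2).trans ht₁T.1.2⟩, hge⟩
    exact absurd (csInf_le hTbdd hτT) (not_le.2 hτ.2)
  -- hence `ρ` is non-increasing on `[0, t₁]`
  have hanti : AntitoneOn ρ (Icc 0 t₁) := by
    refine antitoneOn_of_hasDerivWithinAt_nonpos (convex_Icc 0 t₁) hρc.continuousOn
      (fun τ _ => (hρ' τ).hasDerivWithinAt) fun τ hτ => ?_
    rw [interior_Icc] at hτ
    have hin : ρ τ < r ^ 2 := by
      have := hbelow τ ⟨hτ.1.le, hτ.2⟩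
      linarith
    exact hder_nonpos τ hin
  have h1 : ρ t₁ ≤ ρ 0 := hanti (left_mem_Icc.2 ht₁0.le) (right_mem_Icc.2 ht₁0.le) ht₁0.le
  have h2 : ρ 0 + ε ≤ ρ t₁ := ht₁T.2
  linarith

/-- **VORTICITY VANISHES ON EVERY ADAPTED SOURCE BALL** (`Λ' < 1 + γ`).  Let `(V, P)` be a classical self-similar
profile (`V` smooth, `‖DV‖ ≤ K`), `y*` a zero of `W = γy + V`, `G` a symmetric matrix with `⟪Gh, h⟫ ≥ g₀‖h‖²`
(`g₀ > 0`), and suppose that on the `G`-ball `{⟪G(z−y*), z−y*⟫ < r²}` the adapted stretching of `DW = γI + DV` is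
pinched: `μ⟪Gh, h⟫ ≤ ⟪G DW(z)h, h⟫ ≤ Λ'⟪Gh, h⟫` with `0 < μ` and `Λ' < 1 + γ`.  Then `curl V ≡ 0` on the ball.
(In the window `γ < ½` every HYPERBOLIC SOURCE `y*` admits such data: `max Re λ(DW(y*)) < tr DW = 3γ < 1+γ`.)
[cite: ConstantinIgnatovaVicol2026Putative, §3.5 Thm 3.8 and Prop 3.9 (vanishing at an outgoing node)] -/
theorem curl_eq_zero_on_adaptedSourceBall (hV : ContDiff ℝ ∞ V) {K : ℝ} (hK : ∀ y, ‖fderiv ℝ V y‖ ≤ K)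
    (hprof : IsSelfSimilarEulerProfile γ 0 V P)
    {ystar : EuclideanSpace ℝ (Fin 3)} (hstar : selfSimilarTransport γ 0 V ystar = 0)
    {G : EuclideanSpace ℝ (Fin 3) →L[ℝ] EuclideanSpace ℝ (Fin 3)}
    (hGsym : ∀ u v : EuclideanSpace ℝ (Fin 3), ⟪G u, v⟫ = ⟪u, G v⟫) {g₀ : ℝ} (hg₀ : 0 < g₀)
    (hGpos : ∀ h : EuclideanSpace ℝ (Fin 3), g₀ * ‖h‖ ^ 2 ≤ ⟪G h, h⟫)
    {μ Λ' r : ℝ} (hμ : 0 < μ) (hΛ : Λ' < 1 + γ)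
    (hpinch : ∀ z : EuclideanSpace ℝ (Fin 3), ⟪G (z - ystar), z - ystar⟫ < r ^ 2 →
      ∀ h : EuclideanSpace ℝ (Fin 3), μ * ⟪G h, h⟫ ≤ ⟪G (γ • h + fderiv ℝ V z h), h⟫ ∧
        ⟪G (γ • h + fderiv ℝ V z h), h⟫ ≤ Λ' * ⟪G h, h⟫) :
    ∀ y : EuclideanSpace ℝ (Fin 3), ⟪G (y - ystar), y - ystar⟫ < r ^ 2 → curl V y = 0 := by
  intro y hy
  have hGnn : ∀ h : EuclideanSpace ℝ (Fin 3), 0 ≤ ⟪G h, h⟫ :=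
    fun h => (mul_nonneg hg₀.le (sq_nonneg _)).trans (hGpos h)
  -- the `G`-ball is bounded
  set R : Set (EuclideanSpace ℝ (Fin 3)) := {z | ⟪G (z - ystar), z - ystar⟫ < r ^ 2} with hR
  have hRb : Bornology.IsBounded R := by
    refine (isBounded_closedBall (x := ystar) (r := Real.sqrt (r ^ 2 / g₀))).subset fun z hz => ?_
    rw [mem_closedBall, dist_eq_norm]
    have h1 : g₀ * ‖z - ystar‖ ^ 2 < r ^ 2 := (hGpos _).trans_lt hz
    have h2 : ‖z - ystar‖ ^ 2 ≤ r ^ 2 / g₀ := by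
      rw [le_div_iff₀ hg₀]; linarith
    calc ‖z - ystar‖ = Real.sqrt (‖z - ystar‖ ^ 2) := (Real.sqrt_sq (norm_nonneg _)).symm
      _ ≤ Real.sqrt (r ^ 2 / g₀) := Real.sqrt_le_sqrt h2
  refine curl_eq_zero_of_backward_orbit_stretching_lt hV hK hprof hGsym hg₀ hGpos hΛ hRb
    (fun z hz h => (hpinch z hz h).2) (y := y) fun s hs => ?_
  -- the backward orbit stays in the ball
  have h1 := adaptedSq_flow_neg_le (γ := γ) hV hK hstar hGsym hGnn hμ.le (fun z hz h => (hpinch z hz h).1) hy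
    (t := -s) (by linarith)
  rw [neg_neg] at h1
  exact lt_of_le_of_lt h1 hy

/-- **Euclidean form** (`G = 1`): if on the ball `|z − y*| < r` around a zero `y*` of `W = γy + V` the symmetric
part of `DW = γI + DV` is pinched, `μ|h|² ≤ ⟪DW(z)h, h⟫ ≤ Λ'|h|²` with `0 < μ` and `Λ' < 1 + γ` — i.e. the node is
strictly outgoing in the sense of CIV Def. 3.7 AND the stretching `sym DV ≤ Λ' − γ < 1` nearby — then `curl V ≡ 0`
on the ball (CIV Prop. 3.9 gives vanishing to infinite order AT the node; here: identically NEAR it, no analyticity).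
[cite: ConstantinIgnatovaVicol2026Putative, §3.5 Prop 3.9 (strengthened conclusion)] -/
theorem curl_eq_zero_on_sourceBall (hV : ContDiff ℝ ∞ V) {K : ℝ} (hK : ∀ y, ‖fderiv ℝ V y‖ ≤ K)
    (hprof : IsSelfSimilarEulerProfile γ 0 V P)
    {ystar : EuclideanSpace ℝ (Fin 3)} (hstar : selfSimilarTransport γ 0 V ystar = 0)
    {μ Λ' r : ℝ} (hμ : 0 < μ) (hΛ : Λ' < 1 + γ)
    (hpinch : ∀ z : EuclideanSpace ℝ (Fin 3), ‖z - ystar‖ < r →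
      ∀ h : EuclideanSpace ℝ (Fin 3), μ * ‖h‖ ^ 2 ≤ ⟪γ • h + fderiv ℝ V z h, h⟫ ∧
        ⟪γ • h + fderiv ℝ V z h, h⟫ ≤ Λ' * ‖h‖ ^ 2) :
    ∀ y : EuclideanSpace ℝ (Fin 3), ‖y - ystar‖ < r → curl V y = 0 := by
  intro y hy
  have hr : 0 < r := (norm_nonneg _).trans_lt hy
  -- `G = id`
  have hGsym : ∀ u v : EuclideanSpace ℝ (Fin 3),
      ⟪ContinuousLinearMap.id ℝ (EuclideanSpace ℝ (Fin 3)) u, v⟫ = ⟪u, ContinuousLinearMap.id ℝ _ v⟫ :=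
    fun u v => rfl
  have hGpos : ∀ h : EuclideanSpace ℝ (Fin 3),
      (1 : ℝ) * ‖h‖ ^ 2 ≤ ⟪ContinuousLinearMap.id ℝ (EuclideanSpace ℝ (Fin 3)) h, h⟫ := fun h => by
    rw [ContinuousLinearMap.id_apply, real_inner_self_eq_norm_sq, one_mul]
  have hball : ∀ z : EuclideanSpace ℝ (Fin 3),
      ⟪ContinuousLinearMap.id ℝ (EuclideanSpace ℝ (Fin 3)) (z - ystar), z - ystar⟫ < r ^ 2 ↔ ‖z - ystar‖ < r := by
    intro z
    rw [ContinuousLinearMap.id_apply, real_inner_self_eq_norm_sq]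
    exact ⟨fun h => lt_of_pow_lt_pow_left₀ 2 hr.le h, fun h => pow_lt_pow_left₀ h (norm_nonneg _) two_ne_zero⟩
  refine curl_eq_zero_on_adaptedSourceBall hV hK hprof hstar (G := ContinuousLinearMap.id ℝ _) hGsym one_pos
    hGpos hμ hΛ (r := r) (fun z hz h => ?_) y ((hball y).2 hy)
  have hz' : ‖z - ystar‖ < r := (hball z).1 hz
  have h1 := hpinch z hz' h
  simp only [ContinuousLinearMap.id_apply, real_inner_self_eq_norm_sq]
  exact h1

end Summit.NavierStokesRegularity.NavierStokesRegularity.Theorems.PowerGaugeEulerLiouville.Kelvin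

end
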